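import Literature.Topology.FourManifolds.WildCollarFlap
import Mathlib.Analysis.Calculus.LocalExtr.Basic
import HarnessLib

/-!
# The wild collar flap, II: derivatives and the immersion property

Topic `Literature/Topology/FourManifolds`, continuing `WildCollarFlap.lean` (the explicit flap
`Φ (s, y) = (axial s y, fibre s y)` used to refute the mis-stated slide lemma
`FramedLink.IsStrictHandleSlide.slideDiffeoAligned`). Here: the derivatives of the profiles, the
two partial derivatives of `Φ`, and

* `WildFlap.injective_fderiv_Φ` — **`Φ` is an immersion on `s < 7/100`**: the `y`-derivative of
  the fibre is tangential (`crad · ∂ang/∂y` times the unit tangent), the `s`-derivative has radial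
  component `crad'`; so either `crad' ≠ 0`, or we are on the turn-around `s ∈ (2/100, 3/100)`
  where the axial drift `θh' > 0` alone is transverse to the slice; and where the slice is still
  axial (`sin ψ = 0`) its `y`-derivative is `Λ > 0` along the strand.

Everything is proved; no named facts.
-/

noncomputable section

open Set Real Filter
open scoped ContDiff Topology

namespace Literature.Topology.FourManifolds

/-- Local notation: `𝔼 n` is the model Euclidean space `EuclideanSpace ℝ (Fin n)`. -/
local notation "𝔼 " n:arg => EuclideanSpace ℝ (Fin n)

namespace WildFlap

/-- Shorthand for Mathlib's smooth transition `χ`. [folklore] -/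
local notation "χ" => Real.smoothTransition

/-! ## Derivatives of the profiles -/

/-- On `(-∞, 0]` the smooth transition is at its minimum `0`, so its derivative vanishes there.
[folklore] -/
theorem deriv_χ_of_nonpos {t : ℝ} (ht : t ≤ 0) : deriv Real.smoothTransition t = 0 := by
  have hmin : IsLocalMin Real.smoothTransition t :=
    Filter.Eventually.of_forall fun s ↦ by
      rw [Real.smoothTransition.zero_of_nonpos ht]; exact Real.smoothTransition.nonneg s
  exact hmin.deriv_eq_zero

/-- On `[1, ∞)` the smooth transition is at its maximum `1`, so its derivative vanishes there.
[folklore] -/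
theorem deriv_χ_of_one_le {t : ℝ} (ht : 1 ≤ t) : deriv Real.smoothTransition t = 0 := by
  have hmax : IsLocalMax Real.smoothTransition t :=
    Filter.Eventually.of_forall fun s ↦ by
      rw [Real.smoothTransition.one_of_one_le ht]; exact Real.smoothTransition.le_one s
  exact hmax.deriv_eq_zero

/-- Chain rule: `s ↦ χ (a s - b)` has derivative `a χ' (a s - b)`. [folklore] -/
theorem hasDerivAt_χ_sub (a b t : ℝ) :
    HasDerivAt (fun s ↦ χ (a * s - b)) (a * deriv Real.smoothTransition (a * t - b)) t := by
  have h1 : HasDerivAt (fun s : ℝ ↦ a * s - b) a t := by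
    simpa using ((hasDerivAt_id t).const_mul a).sub_const b
  refine ((Real.smoothTransition.contDiff (n := 1) |>.differentiable (by simp)) (a * t - b)
    |>.hasDerivAt.comp t h1).congr_deriv ?_
  ring

/-- Derivative of the axial drift. [folklore] -/
theorem hasDerivAt_θh (t : ℝ) :
    HasDerivAt θh (50 * deriv Real.smoothTransition (100 * t - 2)) t :=
  ((hasDerivAt_χ_sub 100 2 t).const_mul (1 / 2)).congr_deriv (by ring)

/-- The axial drift has positive derivative on `(2/100, 3/100)`. [folklore] -/
theorem deriv_θh_pos {t : ℝ} (ht : t ∈ Ioo (2 / 100 : ℝ) (3 / 100)) : 0 < deriv θh t := by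
  rw [(hasDerivAt_θh t).deriv]
  have : 0 < deriv Real.smoothTransition (100 * t - 2) :=
    deriv_smoothTransition_pos (by linarith [ht.1]) (by linarith [ht.2])
  linarith

/-- Derivative of the radius profile. [folklore] -/
theorem hasDerivAt_crad (t : ℝ) :
    HasDerivAt crad (1 - 2 * (Real.smoothTransition (100 * t - 2) +
      (t - 2 / 100) * (100 * deriv Real.smoothTransition (100 * t - 2)))) t := by
  have h1 : HasDerivAt (fun s : ℝ ↦ 3 / 100 + s) 1 t := by
    simpa using (hasDerivAt_id t).const_add (3 / 100)
  have h2 : HasDerivAt (fun s : ℝ ↦ s - 2 / 100) 1 t := by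
    simpa using (hasDerivAt_id t).sub_const (2 / 100)
  have h3 := hasDerivAt_χ_sub 100 2 t
  have h5 : HasDerivAt (fun s ↦ 3 / 100 + s - 2 * (s - 2 / 100) * χ (100 * s - 2))
      (1 - (2 * 1 * χ (100 * t - 2) + 2 * (t - 2 / 100) * (100 * deriv χ (100 * t - 2)))) t :=
    h1.sub ((h2.const_mul 2).mul h3)
  refine h5.congr_deriv ?_
  ring

/-- On `s ≤ 2/100` the radius has derivative `1`. [folklore] -/
theorem deriv_crad_of_le {t : ℝ} (ht : t ≤ 2 / 100) : deriv crad t = 1 := by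
  rw [(hasDerivAt_crad t).deriv]
  have h1 : Real.smoothTransition (100 * t - 2) = 0 :=
    Real.smoothTransition.zero_of_nonpos (by linarith)
  have h2 : deriv Real.smoothTransition (100 * t - 2) = 0 :=
    deriv_χ_of_nonpos (by linarith)
  rw [h1, h2]; ring

/-- On `3/100 ≤ s` the radius has derivative `-1`. [folklore] -/
theorem deriv_crad_of_ge {t : ℝ} (ht : 3 / 100 ≤ t) : deriv crad t = -1 := by
  rw [(hasDerivAt_crad t).deriv]
  have h1 : Real.smoothTransition (100 * t - 2) = 1 :=
    Real.smoothTransition.one_of_one_le (by linarith)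
  have h2 : deriv Real.smoothTransition (100 * t - 2) = 0 :=
    deriv_χ_of_one_le (by linarith)
  rw [h1, h2]; ring

/-- **Where the radius is stationary we are on the turn-around**: `deriv crad s = 0` forces
`s ∈ (2/100, 3/100)`. [folklore] -/
theorem mem_Ioo_of_deriv_crad_eq_zero {t : ℝ} (h : deriv crad t = 0) :
    t ∈ Ioo (2 / 100 : ℝ) (3 / 100) := by
  constructor
  · by_contra h'
    rw [deriv_crad_of_le (not_lt.1 h')] at h
    norm_num at h
  · by_contra h'
    rw [deriv_crad_of_ge (not_lt.1 h')] at h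
    norm_num at h

/-- On the turn-around `(2/100, 3/100)` the radius is decreasing where `χ > 1/2`: there
`deriv crad < 0`. [folklore] -/
theorem deriv_crad_neg {t : ℝ} (ht : t ∈ Ioo (2 / 100 : ℝ) (3 / 100))
    (hχ : 1 / 2 < Real.smoothTransition (100 * t - 2)) : deriv crad t < 0 := by
  rw [(hasDerivAt_crad t).deriv]
  have h1 : 0 ≤ deriv Real.smoothTransition (100 * t - 2) :=
    Real.smoothTransition.monotone.deriv_nonneg
  have h2 : 0 ≤ t - 2 / 100 := by linarith [ht.1]
  nlinarith [mul_nonneg h2 h1]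

/-- `ψ` is differentiable. [folklore] -/
theorem differentiable_ψ : Differentiable ℝ ψ := contDiff_ψ.differentiable (by simp)

/-- `Λ` is differentiable. [folklore] -/
theorem differentiable_Λ : Differentiable ℝ Λ := contDiff_Λ.differentiable (by simp)

/-- `θh` is differentiable. [folklore] -/
theorem differentiable_θh : Differentiable ℝ θh := contDiff_θh.differentiable (by simp)

/-- `crad` is differentiable. [folklore] -/
theorem differentiable_crad : Differentiable ℝ crad := contDiff_crad.differentiable (by simp)

/-- `υ` is differentiable. [folklore] -/
theorem differentiable_υ : Differentiable ℝ υ := contDiff_υ.differentiable (by simp)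

/-- On the plateau `(3/200, 3/100)` the turning angle is stationary. [folklore] -/
theorem deriv_ψ_eq_zero {t : ℝ} (ht : t ∈ Ioo (3 / 200 : ℝ) (3 / 100)) : deriv ψ t = 0 := by
  have h : ψ =ᶠ[𝓝 t] fun _ ↦ ψ₀ := by
    filter_upwards [Ioo_mem_nhds ht.1 ht.2] with s hs
    exact ψ_of_mem ⟨hs.1.le, hs.2.le⟩
  rw [h.deriv_eq]; simp

/-- On the plateau `(1/100, 4/100)` the length scale is stationary. [folklore] -/
theorem deriv_Λ_eq_zero {t : ℝ} (ht : t ∈ Ioo (1 / 100 : ℝ) (4 / 100)) : deriv Λ t = 0 := by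
  have h : Λ =ᶠ[𝓝 t] fun _ ↦ (1 / 10 : ℝ) := by
    filter_upwards [Ioo_mem_nhds ht.1 ht.2] with s hs
    exact Λ_of_mem ⟨hs.1.le, hs.2.le⟩
  rw [h.deriv_eq]; simp

/-- The tilt profile is non-decreasing, so its derivative is nonnegative. [folklore] -/
theorem deriv_υ_nonneg (y : ℝ) : 0 ≤ deriv υ y := υ_mono.deriv_nonneg

/-! ## Partial derivatives of the angle, the axial and the fibre coordinate -/

/-- The `s`-derivative of the direction angle. [folklore] -/
def angDs (s y : ℝ) : ℝ := Real.cos (ψ s) * deriv ψ s * (2 * π + 1) * σ y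

/-- The `y`-derivative of the direction angle. [folklore] -/
def angDy (s : ℝ) : ℝ := Real.sin (ψ s) * (2 * π + 1) * (5 / 6)

/-- `hasDerivAt_ang_fst`: a derivative of the explicit profile or map (see the module docstring). [folklore] -/
theorem hasDerivAt_ang_fst (s y : ℝ) : HasDerivAt (fun t ↦ ang t y) (angDs s y) s := by
  unfold ang angDs
  have h1 : HasDerivAt (fun t ↦ Real.sin (ψ t)) (Real.cos (ψ s) * deriv ψ s) s :=
    (differentiable_ψ s).hasDerivAt.sin
  exact ((h1.mul_const (2 * π + 1)).mul_const (σ y)).congr_deriv (by ring)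

/-- `hasDerivAt_σ`: a derivative of the explicit profile or map (see the module docstring). [folklore] -/
theorem hasDerivAt_σ (y : ℝ) : HasDerivAt σ (5 / 6) y := by
  unfold σ
  simpa using ((hasDerivAt_id y).add_const (11 / 10)).const_mul (5 / 6)

/-- `hasDerivAt_ang_snd`: a derivative of the explicit profile or map (see the module docstring). [folklore] -/
theorem hasDerivAt_ang_snd (s y : ℝ) : HasDerivAt (fun t ↦ ang s t) (angDy s) y := by
  unfold ang angDy
  exact ((hasDerivAt_σ y).const_mul (Real.sin (ψ s) * (2 * π + 1))).congr_deriv (by ring)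

/-- The `s`-derivative of the axial coordinate. [folklore] -/
def axialDs (s y : ℝ) : ℝ :=
  deriv θh s + deriv Λ s * y + 1 / 10 * (Real.cos (ψ s) * deriv ψ s) * υ y

/-- The `y`-derivative of the axial coordinate. [folklore] -/
def axialDy (s y : ℝ) : ℝ := Λ s + 1 / 10 * Real.sin (ψ s) * deriv υ y

/-- `hasDerivAt_axial_fst`: a derivative of the explicit profile or map (see the module docstring). [folklore] -/
theorem hasDerivAt_axial_fst (s y : ℝ) : HasDerivAt (fun t ↦ axial t y) (axialDs s y) s := by
  unfold axial axialDs
  have h1 := (differentiable_θh s).hasDerivAt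
  have h2 := ((differentiable_Λ s).hasDerivAt).mul_const y
  have h3 : HasDerivAt (fun t ↦ Real.sin (ψ t)) (Real.cos (ψ s) * deriv ψ s) s :=
    (differentiable_ψ s).hasDerivAt.sin
  have h4 := (h3.const_mul (1 / 10)).mul_const (υ y)
  exact ((h1.add h2).add h4).congr_deriv (by ring)

/-- `hasDerivAt_axial_snd`: a derivative of the explicit profile or map (see the module docstring). [folklore] -/
theorem hasDerivAt_axial_snd (s y : ℝ) : HasDerivAt (fun t ↦ axial s t) (axialDy s y) y := by
  unfold axial axialDy
  have h1 : HasDerivAt (fun t : ℝ ↦ θh s) 0 y := hasDerivAt_const _ _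
  have h2 : HasDerivAt (fun t : ℝ ↦ Λ s * t) (Λ s) y := by
    simpa using (hasDerivAt_id y).const_mul (Λ s)
  have h3 := ((differentiable_υ y).hasDerivAt).const_mul (1 / 10 * Real.sin (ψ s))
  exact ((h1.add h2).add h3).congr_deriv (by ring)

/-- The `s`-derivative of the fibre coordinate: radial part `crad'`, tangential part
`crad · ∂ang/∂s`. [folklore] -/
def fibreDs (s y : ℝ) : 𝔼 2 :=
  vec (deriv crad s * Real.cos (ang s y) - crad s * Real.sin (ang s y) * angDs s y)
    (deriv crad s * Real.sin (ang s y) + crad s * Real.cos (ang s y) * angDs s y)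

/-- The `y`-derivative of the fibre coordinate: tangential, `crad · ∂ang/∂y`. [folklore] -/
def fibreDy (s y : ℝ) : 𝔼 2 :=
  vec (-(crad s * Real.sin (ang s y) * angDy s)) (crad s * Real.cos (ang s y) * angDy s)

/-- Derivative of a `vec`-valued curve from the derivatives of its coordinates. [folklore] -/
theorem hasDerivAt_vec {f g : ℝ → ℝ} {f' g' t : ℝ} (hf : HasDerivAt f f' t)
    (hg : HasDerivAt g g' t) : HasDerivAt (fun x ↦ vec (f x) (g x)) (vec f' g') t := by
  unfold vec
  exact (hf.smul_const e₀).add (hg.smul_const e₁)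

/-- `hasDerivAt_fibre_fst`: a derivative of the explicit profile or map (see the module docstring). [folklore] -/
theorem hasDerivAt_fibre_fst (s y : ℝ) : HasDerivAt (fun t ↦ fibre t y) (fibreDs s y) s := by
  unfold fibre fibreDs
  have hc := (differentiable_crad s).hasDerivAt
  have ha := hasDerivAt_ang_fst s y
  refine hasDerivAt_vec ?_ ?_
  · exact (hc.mul ha.cos).congr_deriv (by ring)
  · exact (hc.mul ha.sin).congr_deriv (by ring)

/-- `hasDerivAt_fibre_snd`: a derivative of the explicit profile or map (see the module docstring). [folklore] -/
theorem hasDerivAt_fibre_snd (s y : ℝ) : HasDerivAt (fun t ↦ fibre s t) (fibreDy s y) y := by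
  unfold fibre fibreDy
  have ha := hasDerivAt_ang_snd s y
  refine hasDerivAt_vec ?_ ?_
  · exact (ha.cos.const_mul (crad s)).congr_deriv (by ring)
  · exact (ha.sin.const_mul (crad s)).congr_deriv (by ring)

/-! ## The two partial derivatives of `Φ` -/

/-- `Φ` is differentiable. [folklore] -/
theorem differentiable_Φ : Differentiable ℝ Φ := contDiff_Φ.differentiable (by simp)

/-- `hasDerivAt_Φ_fst`: a derivative of the explicit profile or map (see the module docstring). [folklore] -/
theorem hasDerivAt_Φ_fst (s y : ℝ) :
    HasDerivAt (fun t ↦ Φ (t, y)) (axialDs s y, fibreDs s y) s :=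
  (hasDerivAt_axial_fst s y).prodMk (hasDerivAt_fibre_fst s y)

/-- `hasDerivAt_Φ_snd`: a derivative of the explicit profile or map (see the module docstring). [folklore] -/
theorem hasDerivAt_Φ_snd (s y : ℝ) :
    HasDerivAt (fun t ↦ Φ (s, t)) (axialDy s y, fibreDy s y) y :=
  (hasDerivAt_axial_snd s y).prodMk (hasDerivAt_fibre_snd s y)

/-- The partial derivative in `s` is the Fréchet derivative on `(1, 0)`. [folklore] -/
theorem fderiv_Φ_apply_one_zero (s y : ℝ) :
    fderiv ℝ Φ (s, y) (1, 0) = (axialDs s y, fibreDs s y) := by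
  have hc : HasDerivAt (fun t : ℝ ↦ (t, y)) ((1 : ℝ), (0 : ℝ)) s :=
    (hasDerivAt_id s).prodMk (hasDerivAt_const s y)
  have h := (differentiable_Φ (s, y)).hasFDerivAt.comp_hasDerivAt s hc
  have h' := hasDerivAt_Φ_fst s y
  exact h.unique h'

/-- The partial derivative in `y` is the Fréchet derivative on `(0, 1)`. [folklore] -/
theorem fderiv_Φ_apply_zero_one (s y : ℝ) :
    fderiv ℝ Φ (s, y) (0, 1) = (axialDy s y, fibreDy s y) := by
  have hc : HasDerivAt (fun t : ℝ ↦ (s, t)) ((0 : ℝ), (1 : ℝ)) y :=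
    (hasDerivAt_const y s).prodMk (hasDerivAt_id y)
  have h := (differentiable_Φ (s, y)).hasFDerivAt.comp_hasDerivAt y hc
  have h' := hasDerivAt_Φ_snd s y
  exact h.unique h'

/-- The Fréchet derivative on a general vector. [folklore] -/
theorem fderiv_Φ_apply (s y a b : ℝ) :
    fderiv ℝ Φ (s, y) (a, b) = a • (axialDs s y, fibreDs s y) + b • (axialDy s y, fibreDy s y) := by
  have : ((a, b) : ℝ × ℝ) = a • ((1 : ℝ), (0 : ℝ)) + b • ((0 : ℝ), (1 : ℝ)) := by simp
  rw [this, map_add, map_smul, map_smul, fderiv_Φ_apply_one_zero, fderiv_Φ_apply_zero_one]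

/-! ## The immersion property -/

/-- Radial and tangential components of the two fibre derivatives. [folklore] -/
theorem fibre_components (s y : ℝ) :
    Real.cos (ang s y) * fibreDs s y 0 + Real.sin (ang s y) * fibreDs s y 1 = deriv crad s ∧
    Real.cos (ang s y) * fibreDy s y 0 + Real.sin (ang s y) * fibreDy s y 1 = 0 ∧
    -Real.sin (ang s y) * fibreDs s y 0 + Real.cos (ang s y) * fibreDs s y 1 =
      crad s * angDs s y ∧
    -Real.sin (ang s y) * fibreDy s y 0 + Real.cos (ang s y) * fibreDy s y 1 =
      crad s * angDy s := by
  have h := Real.sin_sq_add_cos_sq (ang s y)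
  simp only [fibreDs, fibreDy, vec_apply_zero, vec_apply_one]
  refine ⟨?_, ?_, ?_, ?_⟩
  · linear_combination (deriv crad s) * h
  · ring
  · linear_combination (crad s * angDs s y) * h
  · linear_combination (crad s * angDy s) * h

/-- Where the slice is still axial (`sin ψ = 0`, i.e. `s ≤ 1/100`) its `y`-derivative along the
strand is `Λ s > 0`. [folklore] -/
theorem axialDy_pos_of_sin_eq_zero {s : ℝ} (h0 : Real.sin (ψ s) = 0) (y : ℝ) :
    0 < axialDy s y := by
  have hs1 : s ≤ 1 / 100 := by
    by_contra h
    exact (sin_ψ_pos (not_le.1 h)).ne' h0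
  simp only [axialDy, h0, mul_zero, zero_mul, add_zero]
  exact Λ_pos (by linarith)

/-- **The flap is an immersion**: the Fréchet derivative of `Φ` is injective at every point with
`s < 7/100`. [folklore] -/
theorem injective_fderiv_Φ {s : ℝ} (hs : s < 7 / 100) (y : ℝ) :
    Function.Injective (fderiv ℝ Φ (s, y)) := by
  refine (injective_iff_map_eq_zero (fderiv ℝ Φ (s, y))).2 ?_
  rintro ⟨a, b⟩ hab
  rw [fderiv_Φ_apply] at hab
  obtain ⟨hrs, hry, hts, hty⟩ := fibre_components s y
  -- the three scalar equations
  have h1 : a * axialDs s y + b * axialDy s y = 0 := by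
    have := congrArg Prod.fst hab
    simpa using this
  have h2 : a * fibreDs s y 0 + b * fibreDy s y 0 = 0 := by
    have := congrArg (fun q : ℝ × 𝔼 2 ↦ q.2 0) hab
    simpa using this
  have h3 : a * fibreDs s y 1 + b * fibreDy s y 1 = 0 := by
    have := congrArg (fun q : ℝ × 𝔼 2 ↦ q.2 1) hab
    simpa using this
  -- radial and tangential combinations
  have hrad : a * deriv crad s = 0 := by
    linear_combination Real.cos (ang s y) * h2 + Real.sin (ang s y) * h3 - a * hrs - b * hry
  have htan : a * (crad s * angDs s y) + b * (crad s * angDy s) = 0 := by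
    linear_combination (-Real.sin (ang s y)) * h2 + Real.cos (ang s y) * h3 - a * hts - b * hty
  suffices hab0 : a = 0 ∧ b = 0 by simp [hab0.1, hab0.2]
  by_cases hc : deriv crad s = 0
  · -- on the turn-around: `θh' > 0` carries transversality
    have hI := mem_Ioo_of_deriv_crad_eq_zero hc
    have hψ' : deriv ψ s = 0 := deriv_ψ_eq_zero ⟨by linarith [hI.1], hI.2⟩
    have hΛ' : deriv Λ s = 0 := deriv_Λ_eq_zero ⟨by linarith [hI.1], by linarith [hI.2]⟩
    have hDs : axialDs s y = deriv θh s := by simp [axialDs, hψ', hΛ']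
    have hangDs : angDs s y = 0 := by simp [angDs, hψ']
    have hcr : 0 < crad s := by
      have := (crad_ge_iff hI.1).2 ?_
      · linarith
      · -- `χ ≤ 1/2` or not, the radius is positive anyway: bound directly
        by_contra hgt
        exact absurd (deriv_crad_neg hI (not_le.1 hgt)) (by rw [hc]; exact lt_irrefl 0)
    have hangDy : 0 < angDy s := by
      have h1 : 0 < Real.sin (ψ s) := sin_ψ_pos (by linarith [hI.1])
      simp only [angDy]
      have := two_pi_add_one_pos
      positivity
    have hb : b = 0 := by
      rw [hangDs, mul_zero, mul_zero, zero_add] at htan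
      rcases mul_eq_zero.1 htan with hb | hb
      · exact hb
      · exact absurd hb (mul_pos hcr hangDy).ne'
    have ha : a = 0 := by
      rw [hb, zero_mul, add_zero, hDs] at h1
      rcases mul_eq_zero.1 h1 with ha | ha
      · exact ha
      · exact absurd ha (deriv_θh_pos hI).ne'
    exact ⟨ha, hb⟩
  · -- generic point: the radial component kills `a`
    have ha : a = 0 := by
      rcases mul_eq_zero.1 hrad with ha | ha
      · exact ha
      · exact absurd ha hc
    rw [ha, zero_mul, zero_add] at h1 htan
    by_cases hsin : Real.sin (ψ s) = 0
    · have hpos := axialDy_pos_of_sin_eq_zero hsin y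
      rcases mul_eq_zero.1 h1 with hb | hb
      · exact ⟨ha, hb⟩
      · exact absurd hb hpos.ne'
    · have hs1 : 1 / 100 < s := by
        by_contra h
        exact hsin (sin_ψ_of_le (not_lt.1 h))
      have hcr : 0 < crad s := by
        rcases le_or_gt s (2 / 100) with h2 | h2
        · rw [crad_of_le h2]; linarith
        rcases le_or_gt (3 / 100) s with h3 | h3
        · rw [crad_of_ge h3]; linarith
        · -- on `(2/100, 3/100)` with `crad' ≠ 0`
          rcases le_or_gt (Real.smoothTransition (100 * s - 2)) (1 / 2) with hle | hgt
          · linarith [(crad_ge_iff h2).2 hle]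
          · -- decreasing part: still above its value `4/100` at `3/100`... bound via `crad_eq`
            rw [crad_eq]
            have := Real.smoothTransition.le_one (100 * s - 2)
            nlinarith
      have hangDy : 0 < angDy s := by
        have h1 : 0 < Real.sin (ψ s) := lt_of_le_of_ne (sin_ψ_nonneg s) (Ne.symm hsin)
        simp only [angDy]
        have := two_pi_add_one_pos
        positivity
      rcases mul_eq_zero.1 htan with hb | hb
      · exact ⟨ha, hb⟩
      · exact absurd hb (mul_pos hcr hangDy).ne'

end WildFlap

end Literature.Topology.FourManifolds
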